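import Literature.MathematicalPhysics.QuantumFieldTheory.Balaban1983to89.Beta.RemainderHasMajGreenPrimeTowerDecayCoshHeightFree
import Literature.MathematicalPhysics.QuantumFieldTheory.Balaban1983to89.B9Eq349ConjugatedGreenBlockDecayTower
import Literature.MathematicalPhysics.QuantumFieldTheory.Balaban1983to89.B9Eq310HessianHermitian

/-!
# T. Bałaban, *Propagators for lattice gauge theories in a background field*, Commun. Math. Phys. **99** (1985) 389–434
# [Balaban1985BackgroundPropagators] Thm 3.1 (3.42) for `G′_k(U)` AS THE `hG`-SHAPED `HasMaj` OF ROW (D4), WITH THE BIG-BLOCK `L²` DECAY (D-E)_k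
# INHABITED: `∃ (α₁, C, κ′)` BEFORE the height `n`, the volume `m` and the background `U` of print's diagonal window —
# `HasMaj S_m S_m (G′_k(U)↾ℝ) (B⋆(d, p₂, C, κ′, c₁)·e^{−κ′d_∞})` modulo (T) and (D-P)_k only; on the chain's class (unitary `U`, `*`-trace,
# compatible fibre norm) modulo (D-P)_k ONLY

CITATION HEADER (lean-in-tree rule 2026-08-18).  Sources: [Balaban1985BackgroundPropagators] (B9; held
`paper:balaban1985-cmp99-background-propagators`, journal page = PDF page + 388): p. 397 Thm 3.1 *«There exist positive constants M₁, δ₀, a₀, B₀ dependent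
on d and L only … such that … |(G′(U)λ)(x)| … ≦ B₀e^{−δ₀d(y,y′)}|λ| for x ∈ Δ(y), y ∈ Λ_j, supp λ ⊂ Δ(y′)»* (3.42); p. 396 (3.35)–(3.37) (the small-field
window `|U(b) − 1| < α₀η` and the profile of the level averages); (3.49) p. 399 (unit blocks), (3.24)–(3.25) p. 394; p. 416 Thm 3.11;
[Balaban1984PropagatorsI] (B5) p. 36 (the rate of the exponential weight); [Balaban1985Variational] (B11) (180) p. 306, (190) p. 308;
[Balaban1984PropagatorsII] (B6) (2.51)–(2.52) p. 232; [Balaban1985Averaging] (18) p. 21 (compatibility of the fibre norm with the trace).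

WHY THIS FILE (audit cell `pub-balaban`, BINDER row (D4), OWNER lineage `b2b-balaban-beta-an4`, gen 109; «Y3e»).  Gen 108's
`Beta.RemainderHasMajGreenPrimeTowerDecayCoshHeightFree` (Y3d) reads the NE9 OWNER's tower `cosh` assembly through row (D4)'s `hG`-shaped socket with a
constant `B⋆(d, p₂, C_E, κ′, k′, c₁)` free of the height, MODULO three displayed letters: (T) contractive transporters, (D-P)_k the block-local penalty,
(D-E)_k the big-block `L²` decay `‖P_y ∘ G′_k(U) ∘ P_v‖ ≤ C_E·e^{−κ·d_m(v,y)}`.  The (D-E)_k letter IS A TREE THEOREM with the quantifier order print asks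
for: ne9-leaf-03 g74's `B9Eq349ConjugatedGreenBlockDecayTower.exists_block_decay_GpOfUk` — `∃ α₁ C ρ > 0` BEFORE `∀ n η c₀ c₁ m U …` on print's diagonal
window (`ηL^{n+1} = 1`, `c₀(L^{n+1})^d = c₁`, `hRS`, `U(b) ∈ U1`, `‖U(b) − 1‖ ≤ αη`, `α ≤ α₁`, level averages `‖Ū^j(b) − 1‖ ≤ ε_j ≤ αr^j` in `U1`, ANY
positivity witness).  THIS FILE composes the two BY NAME:
* **`exists_hasMaj_GpOfUk_window_sup`** — `∃ α₁ C κ′` (`0 < α₁`, `0 ≤ C`, `0 < κ′`, `2κ′ < 1∕√(4d+1)`) such that at EVERY height `n`, for EVERY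
  period `m`, EVERY background of the window with contractive transporters ((T) `hR`∕`hS` displayed), ANY positivity witness, EVERY big-block family
  `P` and EVERY block-local penalty constant `p₂` ((D-P)_k displayed): `HasMaj S_m S_m ((e∘G′_k(U)∘e⁻¹)↾ℝ) (B⋆·e^{−κ′·d_∞})` with
  `B⋆ = (1 + p₂C√c₁)·2e^{1∕2}·Σ_{l<d}2^{l+1} + √(3^d∕c₁·2^d)·√(2e^{1∕2}·K_d(1∕√(4d+1) − 2κ′))·C·√c₁` — a function of `(d, p₂, C, κ′, c₁)`;
* **`exists_hasMaj_GpOfUk_window`** — the same in the geometry's distance with the CLM packaging (the `hG` binder of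
  `Beta.RemainderChartOriginDerivative.ineq190_fderiv_chartH179_zero_of_letters` token for token, `δ₀ = κ′∕d`);
* **`exists_hasMaj_GpOfUk_window_unitary`** — on the chain's class (unitary `U`, `*`-trace `τ`, fibre norm compatible with `τ`): (T) holds with
  equality (`B9Eq342GreenPrimeSupBound.norm_adTransportW_eq`∕`…_inv_eq`) AND `hRS` is derived (`B9Eq310HessianHermitian.adTransportW_adjoint`) —
  the ONLY displayed analytic letter left is (D-P)_k (`p₂`; NE9's staged `B9Eq324PenaltyBlockLocal` ∕ `…TowerSupBoundDecayPenalty` give `p₂ = |a′|∕√c₁`).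
Mechanism: `exists_block_decay_GpOfUk` ⟹ the (D-E)_k letter `hdec` of Y3d with `C_E := C`, `κ := ρ`; `κ′ := min(ρ, √(1∕(4d+1))∕4)`; `k′ := d`;
`η⁻¹ = L^{n+1}` from `ηL^{n+1} = 1`.  [folklore] composition; one `obtain`, one `exact` per theorem.

HONEST SCOPE.  [folklore] bookkeeping; NO estimate of [5] is proved here (the (D-E)_k estimate is ne9-leaf-03's Combes–Thomas∕coercivity theorem, the
row sum and the weights are the NE9 OWNER's); the operator is [5] Thm 3.1's SITE operator `G′_k(U) = (Δ′_{a′,k}(U))⁻¹`, NOT Thm 3.3's BOND operator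
`Δ_a⁻¹` of NODE D (Sect. C's random walk — the `Gaps/D4WalkBlock*` road; memo `FLAT-LETTERS-LOCATED.md` §19 (ii)); the rate `κ′` and the constants are the
NE9 chain's variational∕window sizes, NOT print's `δ₀, B₀`; the window letters (`hRS` off the unitary class, `U1`-membership of `U` and of the level
averages, the profile `ε_j ≤ αr^j`, `‖U − 1‖ ≤ αη`) are print's running small-field axioms (3.35)–(3.37), DISPLAYED; (D-P)_k stays displayed.  Nothing
identifies Bałaban's step objects (NODE O).  Row (D4) class UNCHANGED (instance 0∕1; D4 DISCHARGE NO DATE); NOT B12 Thm 2, NOT BetaPertH, NOT continuum,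
NOT Clay.  HONEST DEPENDENCY (cell line): continuum YM on T⁴ ⇐ BetaPertH ∧ nine spine estimates (0/9 proved); BetaPertH ⇐ (D1) ∧ (D4) ∧ CAP+tail;
G-an2-4 gates asym, D1 and NE2/3/4.  NEW file importing Y3d, `B9Eq349ConjugatedGreenBlockDecayTower` and `B9Eq310HessianHermitian`; nothing modified;
0 `def`; standard axioms; no `sorry`.
-/

noncomputable section

open scoped BigOperators InnerProductSpace

namespace Literature.MathematicalPhysics.QuantumFieldTheory.Balaban1983to89.Beta.RemainderHasMajGreenPrimeTowerDecayCoshWindow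

open B11SectG B11SupSize190
open B4Sect5Torus (TSite tdist)
open B4Sect5Proof (latticeConst latticeConst_nonneg)
open B5TorusCover (UT)
open B7Prop1Explicit (U1)
open B9Thm34Ext (toB6)
open B9Thm37GlueTorus (torusGeom)
open B9SectCLatticeCarrier (Bond)
open B9Eq311L2Pairing (WL2)
open B9Eq319QprimeTorus (fineP blockCoord)
open B9Eq315QTower (towerP towerP_apply UlevOf)
open B9Eq316TowerFlatIsOneStep (towerP_eq_fineP_pow siteCast)
open B9Eq310HessianOperator (adTransportW)
open B9Eq310HessianHermitian (adTransportW_adjoint)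
open B11Eq103H1Complex (SiteL2K covLaplaceSiteK)
open B9Eq324DeltaPrimeATower (laplacePrimeAk GpOfUk)
open B9Eq342GreenPrimeSupBound (norm_adTransportW_eq norm_adTransportW_inv_eq)
open B9Eq349ConjugatedGreenBlockDecayTower (exists_block_decay_GpOfUk)
open Beta.RemainderHasMajGreenPrimeTowerDecayCoshHeightFree (hasMaj_GpOfUk_of_cosh_letters_heightFree_sup
  hasMaj_GpOfUk_of_cosh_letters_heightFree)

/-- The rate of the window: `κ′ := min(ρ, √(1∕(4d+1))∕4)` satisfies `0 < κ′ ≤ ρ` and `2κ′ < 1∕√(4d+1)`. [folklore] -/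
private theorem rate_window (d : ℕ) {ρ : ℝ} (hρ : 0 < ρ) :
    0 < min ρ (Real.sqrt (1 / (4 * d + 1)) / 4) ∧ min ρ (Real.sqrt (1 / (4 * d + 1)) / 4) ≤ ρ ∧
      2 * min ρ (Real.sqrt (1 / (4 * d + 1)) / 4) < Real.sqrt (1 / (4 * d + 1)) := by
  have hs0 : 0 < Real.sqrt (1 / (4 * (d : ℝ) + 1)) := Real.sqrt_pos.2 (by positivity)
  refine ⟨lt_min hρ (by positivity), min_le_left _ _, ?_⟩
  have h1 : min ρ (Real.sqrt (1 / (4 * d + 1)) / 4) ≤ Real.sqrt (1 / (4 * d + 1)) / 4 := min_le_right _ _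
  linarith

section Window

variable {d : ℕ} (L : ℕ) [NeZero L] {𝔸 : Type*} [NormedRing 𝔸] [NormedAlgebra ℂ 𝔸] [CompleteSpace 𝔸] [NormOneClass 𝔸]
  {W : Type} [NormedAddCommGroup W] [InnerProductSpace ℂ W] [FiniteDimensional ℂ W] (φ : W ≃ₗ[ℂ] 𝔸) {a' Mφ Mφ' : ℝ}
  (hMφ : 0 ≤ Mφ) (hMφ' : 0 ≤ Mφ') (hφ : ∀ w, ‖φ w‖ ≤ Mφ * ‖w‖) (hφ' : ∀ X, ‖φ.symm X‖ ≤ Mφ' * ‖X‖) (ha' : 0 < a')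
  {r : ℝ} (hr0 : 0 ≤ r) (hr1 : r < 1)

include hMφ hMφ' hφ hφ' ha' hr0 hr1 in
/-- **[5] THM 3.1 (3.42) AT EVERY HEIGHT AS `HasMaj S_m S_m (G′_k(U)↾ℝ) (B⋆·e^{−κ′·d_∞})` WITH `∃ (α₁, C, κ′)` BEFORE THE HEIGHT, THE VOLUME AND THE
BACKGROUND** (`1 ≤ d`; given `L`, `M_φ, M_φ′`, `a′ > 0`, a profile ratio `r ∈ [0,1[`): at every height `n` on print's diagonal (`ηL^{n+1} = 1`,
`c₀(L^{n+1})^d = c₁`), for every period `m`, every background `U` of the window (`hRS`, `U(b) ∈ U1`, `‖U(b) − 1‖ ≤ αη`, `α ≤ α₁`, level averages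
`‖Ū^j(b) − 1‖ ≤ ε_j ≤ αr^j` in `U1`) with contractive transporters ((T) `hR`, `hS`), ANY positivity witness, every big-block family `P` and every
block-local penalty constant `p₂ ≥ 0` ((D-P)_k `hP`), in the (190) sup sizes over ANY torus geometry:
`HasMaj S_m S_m ((e∘G′_k(U)∘e⁻¹)↾ℝ) (B⋆·e^{−κ′·d_∞(y,v)})`,
`B⋆ = (1 + p₂C√c₁)·2e^{1∕2}·Σ_{l<d}2^{l+1} + √(3^d∕c₁·2^d)·√(2e^{1∕2}·K_d(1∕√(4d+1) − 2κ′))·C·√c₁` — the (D-E)_k letter of Y3d INHABITED by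
`exists_block_decay_GpOfUk` (`C_E := C`, `κ := ρ`, `κ′ := min(ρ, √(1∕(4d+1))∕4)`, `k′ := d`).
[cite: Balaban1985BackgroundPropagators, Thm 3.1 (3.42) p.397, (3.35)–(3.37) p.396, (3.49) p.399, Thm 3.11 p.416]
[cite: Balaban1984PropagatorsI, p.36] [cite: Balaban1985Variational, (180) p.306, (190) p.308] [cite: Balaban1984PropagatorsII, (2.51)–(2.52) p.232] -/
theorem exists_hasMaj_GpOfUk_window_sup (hd : 1 ≤ d) :
    ∃ α₁ C κ' : ℝ, 0 < α₁ ∧ 0 ≤ C ∧ 0 < κ' ∧ 2 * κ' < Real.sqrt (1 / (4 * d + 1)) ∧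
      ∀ (n : ℕ) (η : ℝ), η * (L : ℝ) ^ (n + 1) = 1 →
      ∀ (c₀ c₁ : ℝ) [Fact (0 < c₀)] [Fact (0 < c₁)], c₀ * ((L : ℝ) ^ (n + 1)) ^ d = c₁ →
      ∀ (m : Fin d → ℕ) [∀ i, NeZero (m i)] (U : Bond d (towerP L m (n + 1)) → 𝔸ˣ),
        (∀ (b : Bond d (towerP L m (n + 1))) (v u : W), ⟪adTransportW φ U b v, u⟫_ℂ = ⟪v, adTransportW φ (fun b => (U b)⁻¹) b u⟫_ℂ) →
        (∀ (b : Bond d (towerP L m (n + 1))) (w : W), ‖adTransportW φ U b w‖ ≤ ‖w‖) →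
        (∀ (b : Bond d (towerP L m (n + 1))) (w : W), ‖adTransportW φ (fun b => (U b)⁻¹) b w‖ ≤ ‖w‖) →
      ∀ (α : ℝ), 0 ≤ α → α ≤ α₁ → (∀ b, U b ∈ U1 𝔸) → (∀ b, ‖(U b : 𝔸) - 1‖ ≤ α * η) →
      ∀ (εU : ℕ → ℝ), (∀ j, 0 ≤ εU j) → (∀ j < n + 1, εU j ≤ α * r ^ j) →
        (∀ (j : ℕ) (b : Bond d (towerP L m (j + 1))), ‖(UlevOf L m (n + 1) U j b : 𝔸) - 1‖ ≤ εU j) →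
        (∀ (j : ℕ) (b : Bond d (towerP L m (j + 1))), UlevOf L m (n + 1) U j b ∈ U1 𝔸) →
      ∀ (hpos' : ∀ x : SiteL2K ℂ d (towerP L m (n + 1)) c₀ W, x ≠ 0 → 0 < RCLike.re ⟪x, laplacePrimeAk L m n φ η U a' (c₁ := c₁) x⟫_ℂ)
        (PS : TSite d m → SiteL2K ℂ d (towerP L m (n + 1)) c₀ W →L[ℂ] SiteL2K ℂ d (towerP L m (n + 1)) c₀ W),
        (∀ (y : TSite d m) (f : SiteL2K ℂ d (towerP L m (n + 1)) c₀ W) (x : TSite d (towerP L m (n + 1))),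
          WL2.equiv ℂ (fun _ : TSite d (towerP L m (n + 1)) => c₀) W (PS y f) x =
            if blockCoord (L ^ (n + 1)) m (siteCast (towerP_eq_fineP_pow L m (n + 1)) x) = y then
              WL2.equiv ℂ (fun _ : TSite d (towerP L m (n + 1)) => c₀) W f x else 0) →
      ∀ (p₂ : ℝ), 0 ≤ p₂ →
        (∀ (v : SiteL2K ℂ d (towerP L m (n + 1)) c₀ W) (x : TSite d (towerP L m (n + 1))),
          ‖WL2.equiv ℂ _ W (laplacePrimeAk L m n φ η U a' (c₁ := c₁) v -
            covLaplaceSiteK ((η : ℂ))⁻¹ (adTransportW φ U) (adTransportW φ fun b => (U b)⁻¹) v) x‖ ≤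
            p₂ * ‖PS (blockCoord (L ^ (n + 1)) m (siteCast (towerP_eq_fineP_pow L m (n + 1)) x)) v‖) →
      ∀ (η₀ L₀ M₀ R : ℝ) (H : Prop),
        HasMaj
          (supSize (toB6 (torusGeom m η₀ L₀ M₀) R H)
            (fun y => Finset.univ.filter fun x : TSite d (towerP L m (n + 1)) =>
              blockCoord (L ^ (n + 1)) m (siteCast (towerP_eq_fineP_pow L m (n + 1)) x) = UT.toSite m y)
            (fun x => UT.ofSite m (blockCoord (L ^ (n + 1)) m (siteCast (towerP_eq_fineP_pow L m (n + 1)) x))) :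
              BlockNorm (toB6 (torusGeom m η₀ L₀ M₀) R H) (TSite d (towerP L m (n + 1)) → W))
          (supSize (toB6 (torusGeom m η₀ L₀ M₀) R H)
            (fun y => Finset.univ.filter fun x : TSite d (towerP L m (n + 1)) =>
              blockCoord (L ^ (n + 1)) m (siteCast (towerP_eq_fineP_pow L m (n + 1)) x) = UT.toSite m y)
            (fun x => UT.ofSite m (blockCoord (L ^ (n + 1)) m (siteCast (towerP_eq_fineP_pow L m (n + 1)) x))))
          (((WL2.linearEquiv ℂ ℂ (fun _ : TSite d (towerP L m (n + 1)) => c₀) :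
                SiteL2K ℂ d (towerP L m (n + 1)) c₀ W ≃ₗ[ℂ] (TSite d (towerP L m (n + 1)) → W)).toLinearMap ∘ₗ
              GpOfUk L m n φ η U a' (c₁ := c₁) hpos' ∘ₗ
              (WL2.linearEquiv ℂ ℂ (fun _ : TSite d (towerP L m (n + 1)) => c₀) :
                SiteL2K ℂ d (towerP L m (n + 1)) c₀ W ≃ₗ[ℂ] (TSite d (towerP L m (n + 1)) → W)).symm.toLinearMap).restrictScalars ℝ)
          (fun y v => ((1 + p₂ * C * Real.sqrt c₁) * (Real.exp (1 / 2) * 2) * (∑ l ∈ Finset.range d, (2 : ℝ) ^ (l + 1)) +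
              Real.sqrt (3 ^ d / c₁ * 2 ^ d) * Real.sqrt ((Real.exp (1 / 2) * 2) * latticeConst d (Real.sqrt (1 / (4 * d + 1)) - 2 * κ')) *
                C * Real.sqrt c₁) *
            Real.exp (-(κ' * tdist m (UT.toSite m y) (UT.toSite m v)))) := by
  obtain ⟨α₁, C, ρ, hα₁, hC, hρ, hdecAll⟩ := exists_block_decay_GpOfUk L φ (a' := a') hMφ hMφ' hφ hφ' ha' hr0 hr1
  obtain ⟨hκ'0, hκ'ρ, h2κ⟩ := rate_window d hρ
  refine ⟨α₁, C, min ρ (Real.sqrt (1 / (4 * d + 1)) / 4), hα₁, hC, hκ'0, h2κ, ?_⟩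
  intro n η hηL c₀ c₁ _ _ hdiag m _ U hRS hR hS α hα hαle hUb hUε εU hεU hεg hLε hLb hpos' PS hPS p₂ hp₂ hP η₀ L₀ M₀ R H
  have hm : ∀ i, 1 ≤ m i := fun i => Nat.one_le_iff_ne_zero.mpr (NeZero.ne (m i))
  have hηN : η⁻¹ = (L : ℝ) ^ (n + 1) := inv_eq_of_mul_eq_one_right hηL
  have hdec : ∀ v y : TSite d m, ‖PS y ∘L LinearMap.toContinuousLinearMap (GpOfUk L m n φ η U a' (c₁ := c₁) hpos') ∘L PS v‖ ≤
      C * Real.exp (-(ρ * tdist m v y)) := fun v y =>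
    hdecAll n η hηL c₀ c₁ hdiag m hm U hRS α hα hαle hUb hUε εU hεU hεg hLε hLb hpos' PS hPS v y
  exact hasMaj_GpOfUk_of_cosh_letters_heightFree_sup L m n φ η U a' hpos' η₀ L₀ M₀ R H (c₁ := c₁) hd hR hS hPS hp₂ hC hκ'0.le hκ'ρ h2κ
    hηN hdiag (le_refl d) hP hdec

include hMφ hMφ' hφ hφ' ha' hr0 hr1 in
/-- **THE SAME IN THE GEOMETRY's OWN DISTANCE, OPERATOR AS A CONTINUOUS LINEAR MAP** (`δ₀ = κ′∕d`): the `hG` binder of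
`Beta.RemainderChartOriginDerivative.ineq190_fderiv_chartH179_zero_of_letters` at every height with `∃ (α₁, C, κ′)` before the height, the volume and
the background of the window; (T) and (D-P)_k displayed.
[cite: Balaban1985BackgroundPropagators, Thm 3.1 (3.42) p.397, (3.35)–(3.37) p.396] [cite: Balaban1985Variational, (180) p.306, (182) p.307, (190) p.308]
[cite: Balaban1984PropagatorsII, (2.51)–(2.52) p.232, (2.54) p.233] -/
theorem exists_hasMaj_GpOfUk_window (hd : 1 ≤ d) :
    ∃ α₁ C κ' : ℝ, 0 < α₁ ∧ 0 ≤ C ∧ 0 < κ' ∧ 2 * κ' < Real.sqrt (1 / (4 * d + 1)) ∧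
      ∀ (n : ℕ) (η : ℝ), η * (L : ℝ) ^ (n + 1) = 1 →
      ∀ (c₀ c₁ : ℝ) [Fact (0 < c₀)] [Fact (0 < c₁)], c₀ * ((L : ℝ) ^ (n + 1)) ^ d = c₁ →
      ∀ (m : Fin d → ℕ) [∀ i, NeZero (m i)] (U : Bond d (towerP L m (n + 1)) → 𝔸ˣ),
        (∀ (b : Bond d (towerP L m (n + 1))) (v u : W), ⟪adTransportW φ U b v, u⟫_ℂ = ⟪v, adTransportW φ (fun b => (U b)⁻¹) b u⟫_ℂ) →
        (∀ (b : Bond d (towerP L m (n + 1))) (w : W), ‖adTransportW φ U b w‖ ≤ ‖w‖) →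
        (∀ (b : Bond d (towerP L m (n + 1))) (w : W), ‖adTransportW φ (fun b => (U b)⁻¹) b w‖ ≤ ‖w‖) →
      ∀ (α : ℝ), 0 ≤ α → α ≤ α₁ → (∀ b, U b ∈ U1 𝔸) → (∀ b, ‖(U b : 𝔸) - 1‖ ≤ α * η) →
      ∀ (εU : ℕ → ℝ), (∀ j, 0 ≤ εU j) → (∀ j < n + 1, εU j ≤ α * r ^ j) →
        (∀ (j : ℕ) (b : Bond d (towerP L m (j + 1))), ‖(UlevOf L m (n + 1) U j b : 𝔸) - 1‖ ≤ εU j) →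
        (∀ (j : ℕ) (b : Bond d (towerP L m (j + 1))), UlevOf L m (n + 1) U j b ∈ U1 𝔸) →
      ∀ (hpos' : ∀ x : SiteL2K ℂ d (towerP L m (n + 1)) c₀ W, x ≠ 0 → 0 < RCLike.re ⟪x, laplacePrimeAk L m n φ η U a' (c₁ := c₁) x⟫_ℂ)
        (PS : TSite d m → SiteL2K ℂ d (towerP L m (n + 1)) c₀ W →L[ℂ] SiteL2K ℂ d (towerP L m (n + 1)) c₀ W),
        (∀ (y : TSite d m) (f : SiteL2K ℂ d (towerP L m (n + 1)) c₀ W) (x : TSite d (towerP L m (n + 1))),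
          WL2.equiv ℂ (fun _ : TSite d (towerP L m (n + 1)) => c₀) W (PS y f) x =
            if blockCoord (L ^ (n + 1)) m (siteCast (towerP_eq_fineP_pow L m (n + 1)) x) = y then
              WL2.equiv ℂ (fun _ : TSite d (towerP L m (n + 1)) => c₀) W f x else 0) →
      ∀ (p₂ : ℝ), 0 ≤ p₂ →
        (∀ (v : SiteL2K ℂ d (towerP L m (n + 1)) c₀ W) (x : TSite d (towerP L m (n + 1))),
          ‖WL2.equiv ℂ _ W (laplacePrimeAk L m n φ η U a' (c₁ := c₁) v -
            covLaplaceSiteK ((η : ℂ))⁻¹ (adTransportW φ U) (adTransportW φ fun b => (U b)⁻¹) v) x‖ ≤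
            p₂ * ‖PS (blockCoord (L ^ (n + 1)) m (siteCast (towerP_eq_fineP_pow L m (n + 1)) x)) v‖) →
      ∀ (η₀ L₀ M₀ R : ℝ) (H : Prop),
        HasMaj
          (supSize (toB6 (torusGeom m η₀ L₀ M₀) R H)
            (fun y => Finset.univ.filter fun x : TSite d (towerP L m (n + 1)) =>
              blockCoord (L ^ (n + 1)) m (siteCast (towerP_eq_fineP_pow L m (n + 1)) x) = UT.toSite m y)
            (fun x => UT.ofSite m (blockCoord (L ^ (n + 1)) m (siteCast (towerP_eq_fineP_pow L m (n + 1)) x))) :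
              BlockNorm (toB6 (torusGeom m η₀ L₀ M₀) R H) (TSite d (towerP L m (n + 1)) → W))
          (supSize (toB6 (torusGeom m η₀ L₀ M₀) R H)
            (fun y => Finset.univ.filter fun x : TSite d (towerP L m (n + 1)) =>
              blockCoord (L ^ (n + 1)) m (siteCast (towerP_eq_fineP_pow L m (n + 1)) x) = UT.toSite m y)
            (fun x => UT.ofSite m (blockCoord (L ^ (n + 1)) m (siteCast (towerP_eq_fineP_pow L m (n + 1)) x))))
          (((LinearMap.toContinuousLinearMap
              ((WL2.linearEquiv ℂ ℂ (fun _ : TSite d (towerP L m (n + 1)) => c₀) :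
                  SiteL2K ℂ d (towerP L m (n + 1)) c₀ W ≃ₗ[ℂ] (TSite d (towerP L m (n + 1)) → W)).toLinearMap ∘ₗ
                GpOfUk L m n φ η U a' (c₁ := c₁) hpos' ∘ₗ
                (WL2.linearEquiv ℂ ℂ (fun _ : TSite d (towerP L m (n + 1)) => c₀) :
                  SiteL2K ℂ d (towerP L m (n + 1)) c₀ W ≃ₗ[ℂ] (TSite d (towerP L m (n + 1)) → W)).symm.toLinearMap)).restrictScalars ℝ :
              (TSite d (towerP L m (n + 1)) → W) →ₗ[ℝ] (TSite d (towerP L m (n + 1)) → W)))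
          (fun y v => ((1 + p₂ * C * Real.sqrt c₁) * (Real.exp (1 / 2) * 2) * (∑ l ∈ Finset.range d, (2 : ℝ) ^ (l + 1)) +
              Real.sqrt (3 ^ d / c₁ * 2 ^ d) * Real.sqrt ((Real.exp (1 / 2) * 2) * latticeConst d (Real.sqrt (1 / (4 * d + 1)) - 2 * κ')) *
                C * Real.sqrt c₁) *
            Real.exp (-(κ' / d * (toB6 (torusGeom m η₀ L₀ M₀) R H).dist y v))) := by
  obtain ⟨α₁, C, ρ, hα₁, hC, hρ, hdecAll⟩ := exists_block_decay_GpOfUk L φ (a' := a') hMφ hMφ' hφ hφ' ha' hr0 hr1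
  obtain ⟨hκ'0, hκ'ρ, h2κ⟩ := rate_window d hρ
  refine ⟨α₁, C, min ρ (Real.sqrt (1 / (4 * d + 1)) / 4), hα₁, hC, hκ'0, h2κ, ?_⟩
  intro n η hηL c₀ c₁ _ _ hdiag m _ U hRS hR hS α hα hαle hUb hUε εU hεU hεg hLε hLb hpos' PS hPS p₂ hp₂ hP η₀ L₀ M₀ R H
  have hm : ∀ i, 1 ≤ m i := fun i => Nat.one_le_iff_ne_zero.mpr (NeZero.ne (m i))
  have hηN : η⁻¹ = (L : ℝ) ^ (n + 1) := inv_eq_of_mul_eq_one_right hηL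
  have hdec : ∀ v y : TSite d m, ‖PS y ∘L LinearMap.toContinuousLinearMap (GpOfUk L m n φ η U a' (c₁ := c₁) hpos') ∘L PS v‖ ≤
      C * Real.exp (-(ρ * tdist m v y)) := fun v y =>
    hdecAll n η hηL c₀ c₁ hdiag m hm U hRS α hα hαle hUb hUε εU hεU hεg hLε hLb hpos' PS hPS v y
  exact hasMaj_GpOfUk_of_cosh_letters_heightFree L m n φ η U a' hpos' η₀ L₀ M₀ R H (c₁ := c₁) hd hR hS hPS hp₂ hC hκ'0.le hκ'ρ h2κ
    hηN hdiag (le_refl d) hP hdec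

end Window

/-! ## The chain's class: unitary `U`, `*`-trace, compatible fibre norm — (T) AND `hRS` inhabited; (D-P)_k the only displayed analytic letter -/

section Unitary

variable {d : ℕ} (L : ℕ) [NeZero L] {𝔸 : Type*} [NormedRing 𝔸] [StarRing 𝔸] [NormedAlgebra ℂ 𝔸] [CompleteSpace 𝔸] [NormOneClass 𝔸]
  {W : Type} [NormedAddCommGroup W] [InnerProductSpace ℂ W] [FiniteDimensional ℂ W] (φ : W ≃ₗ[ℂ] 𝔸) {a' Mφ Mφ' : ℝ}
  (hMφ : 0 ≤ Mφ) (hMφ' : 0 ≤ Mφ') (hφ : ∀ w, ‖φ w‖ ≤ Mφ * ‖w‖) (hφ' : ∀ X, ‖φ.symm X‖ ≤ Mφ' * ‖X‖) (ha' : 0 < a')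
  {r : ℝ} (hr0 : 0 ≤ r) (hr1 : r < 1)
  (τ : 𝔸 →ₗ[ℂ] ℂ) (hτ₂ : ∀ X Y : 𝔸, τ (X * Y) = τ (Y * X)) (hφτ : ∀ X Y : 𝔸, ⟪φ.symm X, φ.symm Y⟫_ℂ = τ (star X * Y))

include hMφ hMφ' hφ hφ' ha' hr0 hr1 hτ₂ hφτ in
/-- **ON THE CHAIN's CLASS: `∃ (α₁, C, κ′)` BEFORE THE HEIGHT, THE VOLUME AND THE BACKGROUND, AND THE ONLY DISPLAYED ANALYTIC LETTER IS (D-P)_k** —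
unitary `U` (`star U(b) = U(b)⁻¹`), a `*`-trace `τ`, the fibre norm compatible with `τ` ([B7] (18)): (T) holds with equality
(`norm_adTransportW_eq`∕`…_inv_eq`) and the transporters are mutually adjoint (`adTransportW_adjoint`), so both are struck from the binder; what remains
displayed is the window ((3.35)–(3.37): `U1`-membership of `U` and of the level averages, `‖U(b) − 1‖ ≤ αη`, `ε_j ≤ αr^j`), ANY positivity witness, the
big-block family and (D-P)_k `p₂`.  Conclusion: the geometry-distance CLM form of `exists_hasMaj_GpOfUk_window`.
[cite: Balaban1985BackgroundPropagators, Thm 3.1 (3.42) p.397, (3.39) p.397, (3.8) p.392, (3.35)–(3.37) p.396] [cite: Balaban1985Averaging, (18) p.21]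
[cite: Balaban1985Variational, (180) p.306, (190) p.308] -/
theorem exists_hasMaj_GpOfUk_window_unitary (hd : 1 ≤ d) :
    ∃ α₁ C κ' : ℝ, 0 < α₁ ∧ 0 ≤ C ∧ 0 < κ' ∧ 2 * κ' < Real.sqrt (1 / (4 * d + 1)) ∧
      ∀ (n : ℕ) (η : ℝ), η * (L : ℝ) ^ (n + 1) = 1 →
      ∀ (c₀ c₁ : ℝ) [Fact (0 < c₀)] [Fact (0 < c₁)], c₀ * ((L : ℝ) ^ (n + 1)) ^ d = c₁ →
      ∀ (m : Fin d → ℕ) [∀ i, NeZero (m i)] (U : Bond d (towerP L m (n + 1)) → 𝔸ˣ),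
        (∀ b, star (U b : 𝔸) = ((U b)⁻¹ : 𝔸ˣ)) →
      ∀ (α : ℝ), 0 ≤ α → α ≤ α₁ → (∀ b, U b ∈ U1 𝔸) → (∀ b, ‖(U b : 𝔸) - 1‖ ≤ α * η) →
      ∀ (εU : ℕ → ℝ), (∀ j, 0 ≤ εU j) → (∀ j < n + 1, εU j ≤ α * r ^ j) →
        (∀ (j : ℕ) (b : Bond d (towerP L m (j + 1))), ‖(UlevOf L m (n + 1) U j b : 𝔸) - 1‖ ≤ εU j) →
        (∀ (j : ℕ) (b : Bond d (towerP L m (j + 1))), UlevOf L m (n + 1) U j b ∈ U1 𝔸) →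
      ∀ (hpos' : ∀ x : SiteL2K ℂ d (towerP L m (n + 1)) c₀ W, x ≠ 0 → 0 < RCLike.re ⟪x, laplacePrimeAk L m n φ η U a' (c₁ := c₁) x⟫_ℂ)
        (PS : TSite d m → SiteL2K ℂ d (towerP L m (n + 1)) c₀ W →L[ℂ] SiteL2K ℂ d (towerP L m (n + 1)) c₀ W),
        (∀ (y : TSite d m) (f : SiteL2K ℂ d (towerP L m (n + 1)) c₀ W) (x : TSite d (towerP L m (n + 1))),
          WL2.equiv ℂ (fun _ : TSite d (towerP L m (n + 1)) => c₀) W (PS y f) x =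
            if blockCoord (L ^ (n + 1)) m (siteCast (towerP_eq_fineP_pow L m (n + 1)) x) = y then
              WL2.equiv ℂ (fun _ : TSite d (towerP L m (n + 1)) => c₀) W f x else 0) →
      ∀ (p₂ : ℝ), 0 ≤ p₂ →
        (∀ (v : SiteL2K ℂ d (towerP L m (n + 1)) c₀ W) (x : TSite d (towerP L m (n + 1))),
          ‖WL2.equiv ℂ _ W (laplacePrimeAk L m n φ η U a' (c₁ := c₁) v -
            covLaplaceSiteK ((η : ℂ))⁻¹ (adTransportW φ U) (adTransportW φ fun b => (U b)⁻¹) v) x‖ ≤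
            p₂ * ‖PS (blockCoord (L ^ (n + 1)) m (siteCast (towerP_eq_fineP_pow L m (n + 1)) x)) v‖) →
      ∀ (η₀ L₀ M₀ R : ℝ) (H : Prop),
        HasMaj
          (supSize (toB6 (torusGeom m η₀ L₀ M₀) R H)
            (fun y => Finset.univ.filter fun x : TSite d (towerP L m (n + 1)) =>
              blockCoord (L ^ (n + 1)) m (siteCast (towerP_eq_fineP_pow L m (n + 1)) x) = UT.toSite m y)
            (fun x => UT.ofSite m (blockCoord (L ^ (n + 1)) m (siteCast (towerP_eq_fineP_pow L m (n + 1)) x))) :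
              BlockNorm (toB6 (torusGeom m η₀ L₀ M₀) R H) (TSite d (towerP L m (n + 1)) → W))
          (supSize (toB6 (torusGeom m η₀ L₀ M₀) R H)
            (fun y => Finset.univ.filter fun x : TSite d (towerP L m (n + 1)) =>
              blockCoord (L ^ (n + 1)) m (siteCast (towerP_eq_fineP_pow L m (n + 1)) x) = UT.toSite m y)
            (fun x => UT.ofSite m (blockCoord (L ^ (n + 1)) m (siteCast (towerP_eq_fineP_pow L m (n + 1)) x))))
          (((LinearMap.toContinuousLinearMap
              ((WL2.linearEquiv ℂ ℂ (fun _ : TSite d (towerP L m (n + 1)) => c₀) :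
                  SiteL2K ℂ d (towerP L m (n + 1)) c₀ W ≃ₗ[ℂ] (TSite d (towerP L m (n + 1)) → W)).toLinearMap ∘ₗ
                GpOfUk L m n φ η U a' (c₁ := c₁) hpos' ∘ₗ
                (WL2.linearEquiv ℂ ℂ (fun _ : TSite d (towerP L m (n + 1)) => c₀) :
                  SiteL2K ℂ d (towerP L m (n + 1)) c₀ W ≃ₗ[ℂ] (TSite d (towerP L m (n + 1)) → W)).symm.toLinearMap)).restrictScalars ℝ :
              (TSite d (towerP L m (n + 1)) → W) →ₗ[ℝ] (TSite d (towerP L m (n + 1)) → W)))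
          (fun y v => ((1 + p₂ * C * Real.sqrt c₁) * (Real.exp (1 / 2) * 2) * (∑ l ∈ Finset.range d, (2 : ℝ) ^ (l + 1)) +
              Real.sqrt (3 ^ d / c₁ * 2 ^ d) * Real.sqrt ((Real.exp (1 / 2) * 2) * latticeConst d (Real.sqrt (1 / (4 * d + 1)) - 2 * κ')) *
                C * Real.sqrt c₁) *
            Real.exp (-(κ' / d * (toB6 (torusGeom m η₀ L₀ M₀) R H).dist y v))) := by
  obtain ⟨α₁, C, κ', hα₁, hC, hκ'0, h2κ, hAll⟩ := exists_hasMaj_GpOfUk_window L φ (a' := a') hMφ hMφ' hφ hφ' ha' hr0 hr1 hd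
  refine ⟨α₁, C, κ', hα₁, hC, hκ'0, h2κ, ?_⟩
  intro n η hηL c₀ c₁ _ _ hdiag m _ U hU α hα hαle hUb hUε εU hεU hεg hLε hLb hpos' PS hPS p₂ hp₂ hP η₀ L₀ M₀ R H
  exact hAll n η hηL c₀ c₁ hdiag m U (adTransportW_adjoint φ τ hτ₂ hU hφτ)
    (fun b w => (norm_adTransportW_eq φ U τ hτ₂ hU hφτ b w).le) (fun b w => (norm_adTransportW_inv_eq φ U τ hτ₂ hU hφτ b w).le)
    α hα hαle hUb hUε εU hεU hεg hLε hLb hpos' PS hPS p₂ hp₂ hP η₀ L₀ M₀ R H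

end Unitary

end Literature.MathematicalPhysics.QuantumFieldTheory.Balaban1983to89.Beta.RemainderHasMajGreenPrimeTowerDecayCoshWindow

end
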